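import Summits.ResolutionOfSingularities.ResolutionOfSingularities.Theorems.PurelyInseparableDim4PolyhedraCFTwo
import HarnessLib

/-!
# [OURS · res-dim4-pi Q-CF∀] Reductions for the open dimensions: multi-step potentials and reduced positions

Cell `res-dim4-pi` (D-0157 DOOR 2), rule question **Q-CF∀** (WORD #29 (b); consortium split of 17:55Z: p-10 =
reductions/theorems · p-8 = support-game tree facts · p-7 = K lane / boxes).  Continues `…PolyhedraCF` /
`…PolyhedraCFTwo` (seat `res-dim4-p-10`, «width 10»).  In the tree: Q-CF∀ on the spine ⇐ CF-weak(3) ∧ CF-weak(4)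
(`SpineCF.exists_cardFirst_purePositionalWin_of_weakWinCF_three_four`).  This file supplies the two landing
shapes for the remaining dimensions:

* **`forcesCF_weak_of_forcesCF_progress`** — the MULTI-STEP potential method: if from every position that is not
  weakly won cardinality-first FORCES «weakly won ∨ μ strictly smaller» (in any finite number of moves), then it
  forces the weak win from everywhere (the shape of `res-dim4-p-7`'s probes F7–F9: «win or Π-drop within L»);
* `IsReduced t I P` (every active column minimum `< t`), `colMin_move_of_ne`, `colMin_move_singleton_add_le`, and
  **`forcesCF_weak_of_reduced`** — divisor moves are cardinality-first and lower `Σ_k ω_k` by `t`, so CF-weak is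
  decided on the REDUCED positions alone.

[OURS · counted 0 · elementary · AI work weaker than expert review] Nothing claimed in dimension 3 or 4; NOTHING here
proves resolution of singularities in dimension ≥ 4 / characteristic `p`.
bears_on: LADDER-RESOLUTION:D157-DOOR2 (res-dim4-pi · Q-CF∀). Supports stmt-ResolutionOfSingularities-16155
(helper).
-/

set_option linter.dupNamespace false -- mandated namespace of this single-conjunct summit

noncomputable section

namespace Summit.ResolutionOfSingularities.ResolutionOfSingularities.Theorems.PIDim4

namespace PolyhedraGame

open Finset
open Literature.AlgebraicGeometry.Resolution
open Literature.AlgebraicGeometry.Resolution.CentreBlowup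

variable {σ : Type} [DecidableEq σ]

/-! ## Reductions for CF-weak(3), CF-weak(4) -/

/-- **Multi-step potential method.** If from every position that is not weakly won cardinality-first FORCES,
in finitely many moves, «weakly won OR a strictly smaller value of `μ`», then cardinality-first forces the weak
win from every position.  (The landing shape for a lookahead argument: `res-dim4-p-7`'s probes F7–F9 observe
exactly this, with growing lookahead, for the potential Π.) [folklore] -/
theorem forcesCF_weak_of_forcesCF_progress {t : ℕ} {I : Finset σ} (μ : Pos σ → ℕ)
    (h : ∀ P : Pos σ, ¬ WeakWon t I P →
      ForcesCF (fun Q => WeakWon t I Q ∨ μ Q < μ P) t I P) :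
    ∀ P : Pos σ, ForcesCF (WeakWon t I) t I P := by
  suffices main : ∀ (n : ℕ) (P : Pos σ), μ P = n → ForcesCF (WeakWon t I) t I P from
    fun P => main _ P rfl
  intro n
  induction n using Nat.strong_induction_on with
  | _ n IH =>
    intro P hn
    rcases Classical.em (WeakWon t I P) with hW | hW
    · exact ForcesCF.won hW
    · refine (h P hW).weaken fun Q hQ => ?_
      rcases hQ with hw | hlt
      · exact ForcesCF.won hw
      · exact IH _ (hn ▸ hlt) _ rfl

/-- A **reduced** position: every active column minimum is `< t` (no divisor move `{i}` is permissible).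
[folklore] -/
def IsReduced (t : ℕ) (I : Finset σ) (P : Pos σ) : Prop := ∀ i ∈ I, colMin i P < t

/-- A move in the chart `j` does not change the column minimum of another coordinate. [folklore] -/
theorem colMin_move_of_ne {t : ℕ} {J : Finset σ} {j k : σ} (hkj : k ≠ j) (P : Pos σ) :
    colMin k (move t J j P) = colMin k P := by
  rcases P.eq_empty_or_nonempty with hP | hP
  · subst hP; rfl
  refine le_antisymm ?_ ?_
  · obtain ⟨s, hs, hsk⟩ := exists_eq_colMin k hP
    have h := colMin_le k (P := move t J j P) (Finset.mem_image_of_mem (chartExponent t J j) hs)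
    rwa [chartExponent_apply_of_ne t J hkj, hsk] at h
  · obtain ⟨s', hs', hsk'⟩ := exists_eq_colMin k (P := move t J j P) (hP.image _)
    obtain ⟨s, hs, rfl⟩ := Finset.mem_image.mp hs'
    rw [chartExponent_apply_of_ne t J hkj] at hsk'
    rw [← hsk']
    exact colMin_le k hs

/-- The divisor move `{i}` lowers the column minimum of `i` by at least `t`. [folklore] -/
theorem colMin_move_singleton_add_le {t : ℕ} {i : σ} {P : Pos σ} (hP : P.Nonempty)
    (hperm : Permissible t ({i} : Finset σ) P) :
    colMin i (move t {i} i P) + t ≤ colMin i P := by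
  obtain ⟨s, hs, hsi⟩ := exists_eq_colMin i hP
  have h := colMin_le i (P := move t {i} i P) (Finset.mem_image_of_mem (chartExponent t {i} i) hs)
  rw [chartExponent_apply_self, degIn_singleton] at h
  have hst : t ≤ s i := by
    have := hperm.2 s hs
    rwa [degIn_singleton] at this
  omega

/-- **Reduction to reduced positions.** At a non-reduced position the divisor move is cardinality-first and
lowers the sum of the active column minima by `t`; hence cardinality-first forces the weak win from EVERY
position as soon as it does so from every REDUCED position that is not yet weakly won. [folklore] -/
theorem forcesCF_weak_of_reduced {t : ℕ} (ht : 0 < t) {I : Finset σ}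
    (h : ∀ P : Pos σ, IsReduced t I P → ¬ WeakWon t I P → ForcesCF (WeakWon t I) t I P) :
    ∀ P : Pos σ, ForcesCF (WeakWon t I) t I P := by
  -- induction on the sum of the active column minima
  suffices main : ∀ (n : ℕ) (P : Pos σ), (∑ k ∈ I, colMin k P) = n → ForcesCF (WeakWon t I) t I P from
    fun P => main _ P rfl
  intro n
  induction n using Nat.strong_induction_on with
  | _ n IH =>
    intro P hn
    rcases Classical.em (WeakWon t I P) with hW | hW
    · exact ForcesCF.won hW
    rcases Classical.em (IsReduced t I P) with hR | hR
    · exact h P hR hW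
    -- a divisor move `{i}` is available: it is cardinality-first and lowers the measure
    have hPne := nonempty_of_not_weakWon hW
    obtain ⟨i, hiI, hi⟩ : ∃ i ∈ I, t ≤ colMin i P := by
      by_contra hc
      push Not at hc
      exact hR fun i hi => hc i hi
    have hperm : Permissible t ({i} : Finset σ) P :=
      ⟨Finset.singleton_nonempty i, fun a ha => by rw [degIn_singleton]; exact hi.trans (colMin_le i ha)⟩
    have hCF : IsCF t I {i} P := by
      refine ⟨Finset.singleton_subset_iff.mpr hiI, hperm, fun J' _ hJ' => ?_⟩
      rw [Finset.card_singleton]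
      exact Finset.card_pos.mpr hJ'.1
    refine ForcesCF.step {i} hCF fun j hj => ?_
    rw [Finset.mem_singleton] at hj
    rw [hj]
    refine IH _ ?_ _ rfl
    rw [← hn]
    have hsplit := fun (Q : Pos σ) => (Finset.add_sum_erase I (fun k => colMin k Q) hiI).symm
    rw [hsplit (move t {i} i P), hsplit P]
    have hrest : ∑ k ∈ I.erase i, colMin k (move t {i} i P) = ∑ k ∈ I.erase i, colMin k P :=
      Finset.sum_congr rfl fun k hk => colMin_move_of_ne (Finset.ne_of_mem_erase hk) P
    rw [hrest]
    have := colMin_move_singleton_add_le hPne hperm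
    omega

end PolyhedraGame

end Summit.ResolutionOfSingularities.ResolutionOfSingularities.Theorems.PIDim4

end
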